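import Mathlib
import Summits.Ventures.PercRepro2.ZMeanProof
import Summits.Ventures.PercRepro2.PendantRoot

/-!
# A sure edge at `a₃` relabels the mark (blind cell PercRepro2, night-1 g7; NIGHT1-G7.md §7)

If the edge `f = {a₃, u}` is SURE (`p f = 1`), configurations with `f` closed carry no mass, and on
the others `a₃` and `u` lie in the same cluster; hence every mass of the mean-field functional `HMFc`
with the mark `a₃` equals the mass with the mark `u`:  `HMFc p ends o a₁ a₂ a₃ b = HMFc p ends o a₁ a₂ u b`
(`HMFc_relabel_of_sure`).  This is the formal content of «the contracted instance `G/f` is the instance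
`a₃ := u`» used throughout the (HMF) leaf step (`HMFLeafStep.HMF_of_leaf_step`,
`HMF_of_leaf_first_order`): the hypothesis `0 ≤ HMFc (p[f ↦ 1]) … a₃ …` may be read with the mark `u`.
-/

namespace Summit.Ventures.PercRepro2

open UnionCluster CovForm PendantRoot

namespace HMFSureEdge

variable {V : Type*} {E : Type*} [Fintype E] [DecidableEq E] [Fintype V] [DecidableEq V]
  {R : Type*} [Field R] [LinearOrder R] [IsStrictOrderedRing R]

variable (p : E → R) (ends : E → Sym2 V) {f : E} {a₃ u : V}

omit [Fintype V] [DecidableEq V] in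
/-- Two events agreeing on `{f open}` have the same probability when `p f = 1`. -/
lemma prob_eq_of_inter_open (hp : IsProbVec p) (h1 : p f = 1) {A B : Set (Config E)}
    (hAB : A ∩ openEdge f = B ∩ openEdge f) : prob p A = prob p B := by
  have hc : prob p (closedEdge f) = 0 := by rw [prob_closedEdge, h1]; ring
  have hz : ∀ X : Set (Config E), prob p (X ∩ (openEdge f)ᶜ) = 0 := fun X => by
    refine le_antisymm ?_ (prob_nonneg hp _)
    rw [← closedEdge_eq_compl]
    calc prob p (X ∩ closedEdge f) ≤ prob p (closedEdge f) := prob_mono hp Set.inter_subset_right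
      _ = 0 := hc
  rw [← prob_inter_add_prob_inter_compl p A (openEdge f),
    ← prob_inter_add_prob_inter_compl p B (openEdge f), hAB, hz, hz]

omit [Fintype E] [DecidableEq E] [Fintype V] [DecidableEq V] in
/-- On `{f open}`, connections to `a₃` are connections to `u`. -/
lemma conn_iff_of_open (hf : ends f = s(a₃, u)) {ω : Config E} (hω : ω ∈ openEdge f) (x : V) :
    Conn ends ω x a₃ ↔ Conn ends ω x u := by
  have h : Conn ends ω a₃ u := conn_of_openAdj ⟨f, hω, hf⟩
  exact ⟨fun hx => conn_trans hx h, fun hx => conn_trans hx (conn_symm h)⟩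

omit [Fintype E] [DecidableEq E] [Fintype V] [DecidableEq V] in
/-- On `{f open}`, connections from `a₃` are connections from `u`. -/
lemma conn_iff_of_open' (hf : ends f = s(a₃, u)) {ω : Config E} (hω : ω ∈ openEdge f) (x : V) :
    Conn ends ω a₃ x ↔ Conn ends ω u x := by
  have h : Conn ends ω a₃ u := conn_of_openAdj ⟨f, hω, hf⟩
  exact ⟨fun hx => conn_trans (conn_symm h) hx, fun hx => conn_trans h hx⟩

omit [Fintype E] [DecidableEq E] [Fintype V] [DecidableEq V] in
/-- Agreement on `O` passes to intersections (left). -/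
lemma inter_open_congr {A B X O : Set (Config E)} (h : A ∩ O = B ∩ O) :
    A ∩ X ∩ O = B ∩ X ∩ O := by
  rw [Set.inter_right_comm, h, Set.inter_right_comm]

omit [Fintype E] [DecidableEq E] [Fintype V] [DecidableEq V] in
/-- Agreement on `O` passes to intersections (right). -/
lemma inter_open_congr' {A B X O : Set (Config E)} (h : A ∩ O = B ∩ O) :
    X ∩ A ∩ O = X ∩ B ∩ O := by
  rw [Set.inter_assoc, h, ← Set.inter_assoc]

section Events

variable {ends}

omit [Fintype E] [DecidableEq E] [Fintype V] [DecidableEq V] in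
/-- On `{f open}`, `PD` with the mark `a₃` is `PD` with the mark `u`. -/
lemma PD_inter_open (hf : ends f = s(a₃, u)) (a₁ a₂ : V) :
    PDEvent ends a₁ a₂ a₃ ∩ openEdge f = PDEvent ends a₁ a₂ u ∩ openEdge f := by
  ext ω
  simp only [PDEvent, Dtilde, inU, Set.mem_inter_iff, Set.mem_compl_iff,
    Set.mem_union, mem_connEvent]
  constructor
  · rintro ⟨⟨h12, hU⟩, hω⟩
    refine ⟨⟨h12, ?_⟩, hω⟩
    rwa [← conn_iff_of_open' ends hf hω, ← conn_iff_of_open' ends hf hω]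
  · rintro ⟨⟨h12, hU⟩, hω⟩
    refine ⟨⟨h12, ?_⟩, hω⟩
    rwa [conn_iff_of_open' ends hf hω, conn_iff_of_open' ends hf hω]

omit [Fintype E] [DecidableEq E] [Fintype V] [DecidableEq V] in
/-- On `{f open}`, `T` with the mark `a₃` is `T` with the mark `u`. -/
lemma T_inter_open (hf : ends f = s(a₃, u)) (a₁ a₂ : V) :
    TEvent ends a₁ a₂ a₃ ∩ openEdge f = TEvent ends a₁ a₂ u ∩ openEdge f := by
  ext ω
  simp only [TEvent, Set.mem_inter_iff, Set.mem_compl_iff, mem_connEvent]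
  constructor
  · rintro ⟨⟨h21, h23⟩, hω⟩
    exact ⟨⟨h21, (conn_iff_of_open ends hf hω a₂).1 h23⟩, hω⟩
  · rintro ⟨⟨h21, h23⟩, hω⟩
    exact ⟨⟨h21, (conn_iff_of_open ends hf hω a₂).2 h23⟩, hω⟩

omit [Fintype E] [DecidableEq E] [Fintype V] [DecidableEq V] in
/-- On `{f open}`, the cluster of `a₃` is the cluster of `u`. -/
lemma cluster_inter_open (hf : ends f = s(a₃, u)) (W : Set V) :
    clusterEvent ends a₃ W ∩ openEdge f = clusterEvent ends u W ∩ openEdge f := by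
  ext ω
  simp only [Set.mem_inter_iff, mem_clusterEvent]
  constructor
  · rintro ⟨hc, hω⟩
    exact ⟨by rw [← cluster_eq_of_conn (conn_of_openAdj ⟨f, hω, hf⟩)]; exact hc, hω⟩
  · rintro ⟨hc, hω⟩
    exact ⟨by rw [cluster_eq_of_conn (conn_of_openAdj ⟨f, hω, hf⟩)]; exact hc, hω⟩

end Events

/-- **A sure edge at `a₃` relabels the mark**: `HMFc … a₃ … = HMFc … u …` when `p f = 1`,
`f = {a₃, u}`. -/
theorem HMFc_relabel_of_sure (hp : IsProbVec p) (hf : ends f = s(a₃, u)) (h1 : p f = 1)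
    (o a₁ a₂ b : V) : HMFc p ends o a₁ a₂ a₃ b = HMFc p ends o a₁ a₂ u b := by
  have hPD : ∀ X : Set (Config E), prob p (PDEvent ends a₁ a₂ a₃ ∩ X) =
      prob p (PDEvent ends a₁ a₂ u ∩ X) := fun X =>
    prob_eq_of_inter_open p hp h1 (inter_open_congr (PD_inter_open hf a₁ a₂))
  have hPDu : prob p (PDEvent ends a₁ a₂ a₃) = prob p (PDEvent ends a₁ a₂ u) :=
    prob_eq_of_inter_open p hp h1 (PD_inter_open hf a₁ a₂)
  have hT : ∀ X : Set (Config E), prob p (TEvent ends a₁ a₂ a₃ ∩ X) =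
      prob p (TEvent ends a₁ a₂ u ∩ X) := fun X =>
    prob_eq_of_inter_open p hp h1 (inter_open_congr (T_inter_open hf a₁ a₂))
  have hTr : ∀ X : Set (Config E), prob p (X ∩ TEvent ends a₁ a₂ a₃) =
      prob p (X ∩ TEvent ends a₁ a₂ u) := fun X =>
    prob_eq_of_inter_open p hp h1 (inter_open_congr' (T_inter_open hf a₁ a₂))
  have hTu : prob p (TEvent ends a₁ a₂ a₃) = prob p (TEvent ends a₁ a₂ u) :=
    prob_eq_of_inter_open p hp h1 (T_inter_open hf a₁ a₂)
  have hT' : ∀ X : Set (Config E), prob p (TEvent ends a₂ a₁ a₃ ∩ X) =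
      prob p (TEvent ends a₂ a₁ u ∩ X) := fun X =>
    prob_eq_of_inter_open p hp h1 (inter_open_congr (T_inter_open hf a₂ a₁))
  have hT'u : prob p (TEvent ends a₂ a₁ a₃) = prob p (TEvent ends a₂ a₁ u) :=
    prob_eq_of_inter_open p hp h1 (T_inter_open hf a₂ a₁)
  have hX : ∀ W : Finset V, prob p (clusterEvent ends a₃ (↑W : Set V)) =
      prob p (clusterEvent ends u (↑W : Set V)) := fun W =>
    prob_eq_of_inter_open p hp h1 (cluster_inter_open hf (↑W : Set V))
  simp only [HMFc, marginC, DEF, Do, massM2, deltaT, EQ3, EQ3o, Xhat_eq_sum, hPD, hPDu, hT, hTr, hTu,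
    hT', hT'u, hX]

end HMFSureEdge

end Summit.Ventures.PercRepro2
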